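import Summits.CriticalPhenomena.SAWScalingLimit.Theorems.TubeLowerBound.Negative.TubeLowerBoundLoadBearing
import Literature.Probability.RandomPlanarGeometry.SAWBridges

/-!
# Negative knowledge on crux `TubeLowerBound` (stmt-CriticalPhenomena-4730), part 3: targets of the line `subcritical-renewal-floor`

Refuter `cdisprove` (standing adversary, cycle 2); the indexed work file is
`Summits/CriticalPhenomena/SAWScalingLimit/Cruxes/TubeLowerBound/Disproof.lean` (section `## Cycle 2`).
The registered skeleton `Cruxes/TubeLowerBound/Lines/subcritical-renewal-floor.lean` (sha aa7e283b6144)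
reduces the crux to five stubs; two of its statements are constrained here (all PROVED, statements
inlined, no named facts):

* `tightTubeFloor_iff` — the target `TightTubeFloor` of stub S5 (`ConeBridgeFloor → TightTubeFloor`)
  is EQUIVALENT to the crux `TubeLowerBound` (the skeleton proves `→`; `←` is `ℓ = max(1,|u−v|)` plus
  `constraints`), so S5 is exactly "`ConeBridgeFloor` implies the crux";
* `coneMass_eq_zero`, `coneBridgeFloor_kappa_le`, `coneBridgeFloor_witness_kappa_le` — in the transfer statement `ConeBridgeFloor`
  (conclusion of stub S4, hypothesis of S5) the end-cone condition at time `0` reads `4|t| ≤ s`, so the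
  cone mass (the double sum, kept inline) vanishes for `s < 4|t|` and ANY witness `(κ, C, c)` has aperture `κ ≤ 1/4`.
-/

noncomputable section

namespace Summit.CriticalPhenomena.SAWScalingLimit.Theorems.TubeLowerBound.Negative

open Literature.Probability.LatticeModels Literature.Probability.RandomPlanarGeometry
open Literature.Probability.RandomPlanarGeometry.SAW
open Summit.CriticalPhenomena.SAWScalingLimit.Theses.SAWRenewalTightness (TubeLowerBound)
open scoped BigOperators

/-! ### S5's target is the crux -/

/-- **`TightTubeFloor ↔ TubeLowerBound`** (`TightTubeFloor` of the skeleton `subcritical-renewal-floor`,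
inlined on the left: the crux at its own scale `ℓ₀ = max(1, |u − v|)` with `0 ≤ C` built in).  `→`:
the tube only widens and `c ℓ^{−C}` only shrinks in `ℓ ≥ ℓ₀` once `0 ≤ C`; `←`: the instance `ℓ = ℓ₀`,
with `0 ≤ C` supplied by `constraints`.  Hence stub S5 of that line is literally "`ConeBridgeFloor` ⇒ crux".
[folklore] -/
theorem tightTubeFloor_iff :
    (∃ C c : ℝ, 0 ≤ C ∧ 0 < c ∧ ∀ (u v : Site 2), ∃ N : ℕ,
      c * (max 1 (dist (Site.toComplex u) (Site.toComplex v))) ^ (-C) ≤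
        ∑ n ∈ Finset.range (N + 1), ∑ _ω ∈ (Zd.sawFun 2 n (v - u)).filter (fun ω => ∀ i ≤ n,
            Metric.infDist (Site.toComplex (u + ω i)) (segment ℝ (Site.toComplex u) (Site.toComplex v)) ≤
              max 1 (dist (Site.toComplex u) (Site.toComplex v)) / 10 + 2),
          criticalFugacity ^ n) ↔ TubeLowerBound := by
  classical
  rw [tubeLowerBound_iff]
  constructor
  · rintro ⟨C, c, hC, hc, h⟩
    refine ⟨C, c, hc, fun u v ℓ hℓ hd => ?_⟩
    obtain ⟨N, hN⟩ := h u v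
    set ℓ₀ : ℝ := max 1 (dist (Site.toComplex u) (Site.toComplex v)) with hℓ₀
    have hℓ₀ℓ : ℓ₀ ≤ ℓ := max_le hℓ hd
    have hℓ₀pos : 0 < ℓ₀ := lt_of_lt_of_le one_pos (le_max_left _ _)
    refine ⟨N, le_trans ?_ (hN.trans ?_)⟩
    · refine mul_le_mul_of_nonneg_left ?_ hc.le
      exact Real.rpow_le_rpow_of_nonpos hℓ₀pos hℓ₀ℓ (by linarith)
    · unfold tubeMass
      refine Finset.sum_le_sum fun n _ => ?_
      refine Finset.sum_le_sum_of_subset_of_nonneg ?_ fun _ _ _ => pow_nonneg criticalFugacity_pos.le n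
      intro ω hω
      rw [Finset.mem_filter] at hω ⊢
      refine ⟨hω.1, fun i hi => (hω.2 i hi).trans ?_⟩
      linarith
  · rintro ⟨C, c, hc, h⟩
    have hC : 0 ≤ C := (constraints hc h).1
    refine ⟨C, c, hC, hc, fun u v => ?_⟩
    exact h u v _ (le_max_left _ _) (le_max_right _ _)

/-! ### `ConeBridgeFloor`: the end cone pins the start -/

/-- **The end cone pins the start**: at `i = 0` (`ω 0 = 0`) the cone condition reads `4|t| ≤ s`, so the cone
mass vanishes identically whenever `s < 4|t|`. [folklore] -/
theorem coneMass_eq_zero (κ : ℝ) {s : ℕ} {t : ℤ} (hst : (s : ℤ) < 4 * |t|) (N : ℕ) :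
    (∑ n ∈ Finset.range (N + 1),
        ∑ _ω ∈ (Zd.bridges 2 n).filter (fun ω => ω n = ![(s : ℤ), t] ∧
            ∀ i ≤ n, |((ω i 1 : ℤ) : ℝ) - (t : ℝ) / (s : ℝ) * ((ω i 0 : ℤ) : ℝ)| ≤ κ * s / 4 + 1 ∧
              4 * |ω i 1 - t| ≤ (s : ℤ) - ω i 0),
          criticalFugacity ^ n) = 0 := by
  classical
  refine Finset.sum_eq_zero fun n _ => Finset.sum_eq_zero fun ω hω => ?_
  exfalso
  rw [Finset.mem_filter] at hω
  obtain ⟨hω, -, hcone⟩ := hω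
  have h0 : ω 0 = 0 := (Zd.mem_saws.1 (Zd.mem_bridges.1 hω).1).1
  have h1 := (hcone 0 (Nat.zero_le n)).2
  rw [h0] at h1
  have e1 : (0 : Site 2) 1 = 0 := rfl
  have e0 : (0 : Site 2) 0 = 0 := rfl
  rw [e1, e0, zero_sub, abs_neg, sub_zero] at h1
  exact absurd (lt_of_le_of_lt h1 hst) (lt_irrefl _)

/-- **Aperture constraint for `ConeBridgeFloor`.** If `(κ, C, c)` witnesses the cone-bridge floor
(hypothesis, = the body of the skeleton's `ConeBridgeFloor`), then `κ ≤ 1/4`: for `κ > 1/4` take `s` with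
`(κ − 1/4)s ≥ 2` and `t = ⌊κ s⌋`; then `|t| ≤ κ s` is admissible but `4t > s`, the cone mass is `0` and the
floor `c s^{−C} > 0` fails. [folklore] -/
theorem coneBridgeFloor_kappa_le {κ C c : ℝ} (hc : 0 < c)
    (h : ∀ (s : ℕ) (t : ℤ), 1 ≤ s → |(t : ℝ)| ≤ κ * s → ∃ N : ℕ, c * (s : ℝ) ^ (-C) ≤
      (∑ n ∈ Finset.range (N + 1),
        ∑ _ω ∈ (Zd.bridges 2 n).filter (fun ω => ω n = ![(s : ℤ), t] ∧
            ∀ i ≤ n, |((ω i 1 : ℤ) : ℝ) - (t : ℝ) / (s : ℝ) * ((ω i 0 : ℤ) : ℝ)| ≤ κ * s / 4 + 1 ∧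
              4 * |ω i 1 - t| ≤ (s : ℤ) - ω i 0),
          criticalFugacity ^ n)) :
    κ ≤ 1 / 4 := by
  by_contra hκ
  push Not at hκ
  have hκ' : 0 < κ - 1 / 4 := by linarith
  obtain ⟨s, hs⟩ : ∃ s : ℕ, 2 / (κ - 1 / 4) ≤ s := exists_nat_ge _
  have hs2 : 2 ≤ (s : ℝ) * (κ - 1 / 4) := (div_le_iff₀ hκ').1 hs
  have hs1 : 1 ≤ s := by
    rcases Nat.eq_zero_or_pos s with rfl | hpos
    · norm_num at hs2
    · exact hpos
  set t : ℤ := ⌊κ * s⌋ with ht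
  have hκs : 0 ≤ κ * s := by
    have : (0 : ℝ) ≤ s := Nat.cast_nonneg s
    nlinarith
  have ht0 : (0 : ℤ) ≤ t := Int.floor_nonneg.2 hκs
  have ht0' : (0 : ℝ) ≤ (t : ℝ) := by exact_mod_cast ht0
  have htle : (t : ℝ) ≤ κ * s := Int.floor_le _
  have htgt : κ * s < (t : ℝ) + 1 := Int.lt_floor_add_one _
  obtain ⟨N, hN⟩ := h s t hs1 (by rw [abs_of_nonneg ht0']; exact htle)
  have hst : (s : ℤ) < 4 * |t| := by
    rw [abs_of_nonneg ht0]
    have : (s : ℝ) < 4 * (t : ℝ) := by nlinarith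
    exact_mod_cast this
  rw [coneMass_eq_zero κ hst] at hN
  have : 0 < c * (s : ℝ) ^ (-C) :=
    mul_pos hc (Real.rpow_pos_of_pos (by exact_mod_cast hs1) _)
  linarith

/-- Packaging on the skeleton's existential form: `ConeBridgeFloor` (inlined) yields a witness with
`κ ≤ 1/4`. [folklore] -/
theorem coneBridgeFloor_witness_kappa_le
    (h : ∃ κ C c : ℝ, 0 < κ ∧ 0 < c ∧ ∀ (s : ℕ) (t : ℤ), 1 ≤ s → |(t : ℝ)| ≤ κ * s →
      ∃ N : ℕ, c * (s : ℝ) ^ (-C) ≤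
      (∑ n ∈ Finset.range (N + 1),
        ∑ _ω ∈ (Zd.bridges 2 n).filter (fun ω => ω n = ![(s : ℤ), t] ∧
            ∀ i ≤ n, |((ω i 1 : ℤ) : ℝ) - (t : ℝ) / (s : ℝ) * ((ω i 0 : ℤ) : ℝ)| ≤ κ * s / 4 + 1 ∧
              4 * |ω i 1 - t| ≤ (s : ℤ) - ω i 0),
          criticalFugacity ^ n)) :
    ∃ κ C c : ℝ, 0 < κ ∧ κ ≤ 1 / 4 ∧ 0 < c ∧ ∀ (s : ℕ) (t : ℤ), 1 ≤ s → |(t : ℝ)| ≤ κ * s →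
      ∃ N : ℕ, c * (s : ℝ) ^ (-C) ≤
      (∑ n ∈ Finset.range (N + 1),
        ∑ _ω ∈ (Zd.bridges 2 n).filter (fun ω => ω n = ![(s : ℤ), t] ∧
            ∀ i ≤ n, |((ω i 1 : ℤ) : ℝ) - (t : ℝ) / (s : ℝ) * ((ω i 0 : ℤ) : ℝ)| ≤ κ * s / 4 + 1 ∧
              4 * |ω i 1 - t| ≤ (s : ℤ) - ω i 0),
          criticalFugacity ^ n) := by
  obtain ⟨κ, C, c, hκ, hc, h⟩ := h
  exact ⟨κ, C, c, hκ, coneBridgeFloor_kappa_le hc h, hc, h⟩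

end Summit.CriticalPhenomena.SAWScalingLimit.Theorems.TubeLowerBound.Negative

end
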